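import Summits.QuantumFields.YangMills.Theorems.UnitScaleTiltProp7CovWeightedRowMember
import HarnessLib

/-!
# Route `UnitScaleTilt`, crux K1 «MinimiserStabilityRegPr» (stmt-QuantumFields-19200), route-R E′ path (α′), (E1-b) covariant, row (hK₂-cov) — FILE F4c′-cov «ALL SCALES»:
# the `hK₂sup` binder of ✓ `Prop7LinearCorrectorClose.linCorr_gauge_le_of_supplier_rows` at the member of record WITHOUT the scale floor `1024 ≤ ℓ_k` of ✓ `Prop7CovWeightedRowMember.weight_row_member`

Cell `ym3-torus`, width seat `ym3-torus-px11` (gen 3), LEAD of the (hK₂-cov) chain (routeR-w3 g6 WORDS (8)–(10), THE CUT 22:51:18Z: F4b∕F4c = px11); LOCATE 19200 evidence #57.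
`--kind proof --supports stmt-QuantumFields-19200 --as helper`, count-neutral.  THEOREMS ONLY (0 `def`, 0 `sorry`).  YM₃ on T³ is a ladder rung (R3) — not d = 4, not infinite
volume, not a mass gap, not the Clay problem; nothing here claims the stub, the crux or the gap.

THE POINT.  ✓ `weight_row_member` (F4c-cov) carries the floor `1024 ≤ (ℓ+1)^{K−n}` that the near∕far geometry of F4b-cov needs.  Below the floor the row is CRUDE and needs no geometry:
`‖Δ_𝒰φ_H(x)‖ ≤ √(Σ_{B(x,ℓ_k)} hs Δ_𝒰φ_H) ≤ √(C_V ℓ_k³ M²) ≤ 32·√C_V·ℓ_k·M ≤ 32768·√C_V·M` (✓ `member_mass`, `ℓ_k ≤ 1024`), `‖Δ_𝒰(φ−φ_H)(x)‖ ≤ M + ‖Δ_𝒰φ_H(x)‖`, `w ≤ ℓ_k`.  One constant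
`C₂ := 1 + 81A(1+T₀)²√C_V + 32768√C_V` serves both regimes, so the `hK₂sup` row holds for `F = ⟨ℓ+1, hL, m, hm⟩` with the member's standing data ONLY (`RegPr`, `M·α₀ ≤ a₅`, `α₀ ≤ 1`,
px4 g3's window row) — exactly the hypotheses of the other (E1-b) suppliers.

WHAT IS PROVED (ns `…Theorems.Prop7CovWeightedRowMemberAllScales`): ★★★ `weight_row_member_all_scales` — `∃ c₃₅ a₅ C₂ > 0, ∀ member data, RegPr → window → «✓p675883's hK₂sup body»`.
HONEST SCOPE.  Bookkeeping over ✓ `Prop7CovWeightedRowMember` (`member_frames`, `member_mass`, `final_algebra`) and ✓ `Prop7CovWeightedLaplaceRow`; nothing of Bałaban's is asserted.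

References: T. Bałaban, CMP 102 (1985) 277–309 [Balaban1985Variational] (Prop. 7 p.299); CMP 99 (1985) 389–434 [Balaban1985BackgroundPropagators] ((3.8) p.392, (3.35) p.396).
-/

set_option autoImplicit false

noncomputable section

open scoped BigOperators Matrix.Norms.L2Operator Matrix

namespace Summit.QuantumFields.YangMills.Theorems.Prop7CovWeightedRowMemberAllScales

open Literature.MathematicalPhysics.QuantumFieldTheory.Balaban1983to89
open Literature.MathematicalPhysics.QuantumFieldTheory.Balaban1983to89.T3ContinuumYM3Torus
open Literature.MathematicalPhysics.QuantumFieldTheory.Balaban1983to89.T3PrintedRegularMinimiser (RegPr)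
open Literature.MathematicalPhysics.QuantumFieldTheory.Balaban1983to89.B6GlobalChartV1 (PV)
open Finset
open B9Eq39Adjoint (covD divB)
open B9TorusCalculus (torusT)
open B10Eq27TorusAxialLog (unitsField toUField)
open B15DeterminingSets (embIter)
open B3Taylor310LocalRemainder (tdist_self)
open Summit.QuantumFields.YangMills.Theorems.Prop7SectET3Members (hd3)
open Summit.QuantumFields.YangMills.Theorems.Prop7CovHodgeSplit (unitsField_toUField_mem_unitary)
open Summit.QuantumFields.YangMills.Theorems.Prop7ExactCorrectorGaugeSockets (unitsField_toUField_norm_le_one)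
open Summit.QuantumFields.YangMills.Theorems.Prop7CovInterpKernelDual (covLaplace_sub)
open Summit.QuantumFields.YangMills.Theorems.Prop7CovWeightedRowScalings (sqrt_letters)
open Summit.QuantumFields.YangMills.Theorems.Prop7CovWeightedLaplaceRow (weight_mul_norm_covLaplace_interp_error_le)
open Summit.QuantumFields.YangMills.Theorems.Prop7CovWeightedRowMember (member_frames member_mass final_algebra)

/-! ## ★★★ All scales: the floor `1024 ≤ ℓ_k` removed -/
section AllScales
variable {ℓ : ℕ} {hL : Odd (ℓ + 1) ∧ 1 < ℓ + 1}

open Summit.QuantumFields.YangMills.Theorems.Prop7CovPinJunkPhi (norm_le_sqrt_mass)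

/-- ★★★ **THE (hK₂-cov) SUPPLIER ROW AT THE MEMBER, EVERY SCALE** — `weight_row_member` without the floor `1024 ≤ (ℓ+1)^{K−n}`: below the floor the row is CRUDE
(`‖Δ_𝒰φ_H(x)‖ ≤ √𝓜 ≤ √C_V·ℓ_k^{3∕2}·M ≤ 32768√C_V·M`, `w ≤ ℓ_k`), above it is §3; one constant `C₂ := 1 + 81A(1+T₀)²√C_V + 32768√C_V` serves both.  This is ✓p675883's `hK₂sup`
binder for `F = ⟨ℓ+1, hL, m, hm⟩` with the member's standing data only (`RegPr`, `M·α₀ ≤ a₅`, `α₀ ≤ 1`, px4 g3's window row).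
[cite: Balaban1985Variational, Prop. 7 p.299; Balaban1985BackgroundPropagators, (3.8) p.392, (3.35) p.396] -/
theorem weight_row_member_all_scales (hℓ4 : 4 ≤ ℓ) : ∃ c35 a₅ C₂ : ℝ, 0 < c35 ∧ 0 < a₅ ∧ 0 < C₂ ∧
    ∀ (hℓ : 4 ≤ ℓ) (m : ℕ) (hm : 1 ≤ m) (n K a' R : ℕ) (hk1 : 1 ≤ K - n) (hsize : a' + 3 ≤ m + n) (hM8 : 8 ≤ (ℓ + 1) ^ a')
      (hR2 : 2 * (ℓ + 1) ^ 2 ≤ R) (α₀ : ℝ), 0 < α₀ → α₀ ≤ 1 → ((ℓ + 1 : ℕ) : ℝ) * (((ℓ + 1) ^ a' : ℕ) : ℝ) * α₀ ≤ a₅ →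
      ∀ W : GaugeField (PV 2 ℓ m K hd3 hL) 0 (Matrix.specialUnitaryGroup (Fin 2) ℂ),
        RegPr (⟨ℓ + 1, hL, m, hm⟩ : T3Family) n K α₀ W →
        (4 * 2197 * (24 * 289 * 24576 * 46116) : ℝ) * ((2 : ℕ) : ℝ) ^ 2 * ((((PV 2 ℓ m K hd3 hL).L : ℝ)) ^ (K - n)) ^ 4
            * ((((PV 2 ℓ m K hd3 hL).d : ℝ)) ^ 2 * (4 * ((2 : ℕ) : ℝ) * (α₀ * ((((PV 2 ℓ m K hd3 hL).L : ℝ))⁻¹) ^ (2 * (K - n))) ^ 2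
              + (2 * ((((ℓ + 1 : ℕ) : ℝ) ^ (K - n))⁻¹ * ((((ℓ + 1 : ℕ) : ℝ) ^ (K - n))⁻¹ * (c35 * (((ℓ + 1 : ℕ) : ℝ) * (((ℓ + 1) ^ a' : ℕ) : ℝ)) * α₀))
                  * Real.exp ((((ℓ + 1 : ℕ) : ℝ) ^ (K - n))⁻¹ * (c35 * (((ℓ + 1 : ℕ) : ℝ) * (((ℓ + 1) ^ a' : ℕ) : ℝ)) * α₀)))
                + 4 * ((((ℓ + 1 : ℕ) : ℝ) ^ (K - n))⁻¹ * (c35 * (((ℓ + 1 : ℕ) : ℝ) * (((ℓ + 1) ^ a' : ℕ) : ℝ)) * α₀)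
                  * Real.exp ((((ℓ + 1 : ℕ) : ℝ) ^ (K - n))⁻¹ * (c35 * (((ℓ + 1 : ℕ) : ℝ) * (((ℓ + 1) ^ a' : ℕ) : ℝ)) * α₀))) ^ 2) ^ 2)) ≤ 1 / 4 →
        ∀ (φ φH : Site (PV 2 ℓ m K hd3 hL) 0 → Matrix (Fin 2) (Fin 2) ℂ),
          (∀ y : Site (PV 2 ℓ m K hd3 hL) (K - n), φH (embIter (K - n) y) = φ (embIter (K - n) y)) →
          (∀ x : Site (PV 2 ℓ m K hd3 hL) 0, x ∉ Set.range (embIter (K - n)) →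
            divB (torusT (PV 2 ℓ m K hd3 hL) 0) (fun κ z => unitsField (toUField W) ⟨z, κ⟩) (fun μ => covD (torusT (PV 2 ℓ m K hd3 hL) 0) (fun κ z => unitsField (toUField W) ⟨z, κ⟩) μ
                (fun y => divB (torusT (PV 2 ℓ m K hd3 hL) 0) (fun κ z => unitsField (toUField W) ⟨z, κ⟩) (fun ν => covD (torusT (PV 2 ℓ m K hd3 hL) 0) (fun κ z => unitsField (toUField W) ⟨z, κ⟩) ν φH) y)) x = 0) →
          ∀ M : ℝ, (∀ z, ‖divB (torusT (PV 2 ℓ m K hd3 hL) 0) (fun κ z => unitsField (toUField W) ⟨z, κ⟩) (fun μ => covD (torusT (PV 2 ℓ m K hd3 hL) 0) (fun κ z => unitsField (toUField W) ⟨z, κ⟩) μ φ) z‖ ≤ M) →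
          ∀ w' : Site (PV 2 ℓ m K hd3 hL) 0 → ℝ,
            (∀ (x : Site (PV 2 ℓ m K hd3 hL) 0) (y : Site (PV 2 ℓ m K hd3 hL) (K - n)), w' x ≤ (Site.tdist x (embIter (K - n) y) : ℝ)) →
            (∀ x, w' x ≤ (((⟨ℓ + 1, hL, m, hm⟩ : T3Family).L : ℕ) : ℝ) ^ (K - n)) → (∀ x, 0 ≤ w' x) →
          ∀ x : Site (PV 2 ℓ m K hd3 hL) 0,
            w' x * ‖divB (torusT (PV 2 ℓ m K hd3 hL) 0) (fun κ z => unitsField (toUField W) ⟨z, κ⟩) (fun μ => covD (torusT (PV 2 ℓ m K hd3 hL) 0) (fun κ z => unitsField (toUField W) ⟨z, κ⟩) μ (fun y => φ y - φH y)) x‖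
              ≤ C₂ * (((⟨ℓ + 1, hL, m, hm⟩ : T3Family).L : ℕ) : ℝ) ^ (K - n) * M := by
  classical
  obtain ⟨a₅f, T₀, ha₅f, hT₀, HF⟩ := member_frames (hL := hL) hℓ4
  obtain ⟨c35, a₅m, CV, hc35, ha₅m, hCV, HM⟩ := member_mass (hL := hL) hℓ4
  obtain ⟨A, hA, Hrow⟩ := weight_mul_norm_covLaplace_interp_error_le (N := 2)
  refine ⟨c35, min a₅f a₅m, 1 + A * 81 * (1 + T₀) ^ 2 * Real.sqrt CV + 32768 * Real.sqrt CV, hc35, lt_min ha₅f ha₅m, by positivity, ?_⟩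
  intro hℓ m hm n K a' R hk1 hsize hM8 hR2 α₀ hα₀ hα1 hMα W hreg hwin φ φH hH hEL M hM w' hwC hwℓ hw0 x
  have hmass := HM hℓ m hm n K a' R hk1 hsize hM8 hR2 α₀ hα₀ hα1 (hMα.trans (min_le_right _ _)) W hreg hwin φ φH hH hEL M hM
  have hFL : (((⟨ℓ + 1, hL, m, hm⟩ : T3Family).L : ℕ) : ℝ) ^ (K - n) = (((PV 2 ℓ m K hd3 hL).L : ℝ)) ^ (K - n) := rfl
  rw [hFL] at hwℓ ⊢
  have hℓk1 : (1 : ℝ) ≤ (((PV 2 ℓ m K hd3 hL).L : ℝ)) ^ (K - n) := one_le_pow₀ (by exact_mod_cast (PV 2 ℓ m K hd3 hL).L_pos)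
  have hℓk0 : (0 : ℝ) < (((PV 2 ℓ m K hd3 hL).L : ℝ)) ^ (K - n) := by linarith
  have hM0 : 0 ≤ M := (norm_nonneg _).trans (hM x)
  have hsC : 0 ≤ Real.sqrt CV := Real.sqrt_nonneg _
  have hunit : 0 ≤ (((PV 2 ℓ m K hd3 hL).L : ℝ)) ^ (K - n) * M := by positivity
  by_cases h1024 : 1024 ≤ (ℓ + 1) ^ (K - n)
  · -- above the floor: §3 verbatim
    obtain ⟨t, τ₁, τ₂, ht0, htT, hτ₁, hτ₂, hfr⟩ := HF hℓ m hm n K a' R hk1 hsize hM8 hR2 α₀ hα₀ (hMα.trans (min_le_left _ _)) W hreg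
    have hd : (PV 2 ℓ m K hd3 hL).d = 3 := rfl
    have hk : K - n ≤ (PV 2 ℓ m K hd3 hL).m + (PV 2 ℓ m K hd3 hL).K := show K - n ≤ m + K by omega
    have h1024' : 1024 ≤ (PV 2 ℓ m K hd3 hL).L ^ (K - n) := h1024
    have hUu := fun (ν : Fin (PV 2 ℓ m K hd3 hL).d) (z : Site (PV 2 ℓ m K hd3 hL) 0) => unitsField_toUField_mem_unitary W ν z
    have hU := fun (κ : Fin (PV 2 ℓ m K hd3 hL).d) (z : Site (PV 2 ℓ m K hd3 hL) 0) => unitsField_toUField_norm_le_one W ⟨z, κ⟩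
    have H := Hrow (PV 2 ℓ m K hd3 hL) hd (K - n) hk h1024' (fun κ z => unitsField (toUField W) ⟨z, κ⟩) hUu hU φ φH hEL M hM t τ₁ τ₂ ht0 hτ₁ hτ₂ hfr _ hmass w' hwC hwℓ hw0 x
    have h81 : (1 + 2 * ((2 : ℕ) : ℝ) ^ 2) ^ 2 = 81 := by norm_num
    rw [h81] at H
    refine H.trans ((final_algebra hA.le ht0 htT hCV.le hℓk1 hM0).trans ?_)
    have e : (1 + A * 81 * (1 + T₀) ^ 2 * Real.sqrt CV + 32768 * Real.sqrt CV) * (((PV 2 ℓ m K hd3 hL).L : ℝ)) ^ (K - n) * M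
        = (1 + A * 81 * (1 + T₀) ^ 2 * Real.sqrt CV) * (((PV 2 ℓ m K hd3 hL).L : ℝ)) ^ (K - n) * M + 32768 * Real.sqrt CV * ((((PV 2 ℓ m K hd3 hL).L : ℝ)) ^ (K - n) * M) := by ring
    rw [e]
    linarith [mul_nonneg (mul_nonneg (by norm_num : (0:ℝ) ≤ 32768) hsC) hunit]
  · -- below the floor: the crude row
    have hlt : (((PV 2 ℓ m K hd3 hL).L : ℝ)) ^ (K - n) ≤ 1024 := by
      have h : (PV 2 ℓ m K hd3 hL).L ^ (K - n) ≤ 1024 := (not_le.1 h1024).le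
      exact_mod_cast h
    have hsqrt : Real.sqrt ((((PV 2 ℓ m K hd3 hL).L : ℝ)) ^ (K - n)) ≤ 32 := by
      rw [show (32 : ℝ) = Real.sqrt (32 ^ 2) by rw [Real.sqrt_sq (by norm_num)]]
      exact Real.sqrt_le_sqrt (by linarith)
    obtain ⟨-, -, -, hr3⟩ := sqrt_letters hℓk1
    have hV : ‖divB (torusT (PV 2 ℓ m K hd3 hL) 0) (fun κ z => unitsField (toUField W) ⟨z, κ⟩) (fun ν => covD (torusT (PV 2 ℓ m K hd3 hL) 0) (fun κ z => unitsField (toUField W) ⟨z, κ⟩) ν φH) x‖ ≤ Real.sqrt CV * (((PV 2 ℓ m K hd3 hL).L : ℝ)) ^ (K - n) * 32 * M := by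
      refine ((norm_le_sqrt_mass _ x ((PV 2 ℓ m K hd3 hL).L ^ (K - n)) x (by rw [tdist_self]; exact Nat.zero_le _)).trans (Real.sqrt_le_sqrt (hmass x))).trans ?_
      rw [Real.sqrt_mul (by positivity), Real.sqrt_mul (by positivity), hr3, Real.sqrt_sq hM0]
      have h := mul_le_mul_of_nonneg_left hsqrt (by positivity : (0:ℝ) ≤ Real.sqrt CV * (((PV 2 ℓ m K hd3 hL).L : ℝ)) ^ (K - n) * M)
      nlinarith [h]
    -- `‖Δ(φ − φ_H)(x)‖ ≤ M + ‖V x‖`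
    have hsplit : ‖divB (torusT (PV 2 ℓ m K hd3 hL) 0) (fun κ z => unitsField (toUField W) ⟨z, κ⟩) (fun μ => covD (torusT (PV 2 ℓ m K hd3 hL) 0) (fun κ z => unitsField (toUField W) ⟨z, κ⟩) μ (fun y => φ y - φH y)) x‖
        ≤ M + ‖divB (torusT (PV 2 ℓ m K hd3 hL) 0) (fun κ z => unitsField (toUField W) ⟨z, κ⟩) (fun ν => covD (torusT (PV 2 ℓ m K hd3 hL) 0) (fun κ z => unitsField (toUField W) ⟨z, κ⟩) ν φH) x‖ := by
      rw [covLaplace_sub (U := (fun κ z => unitsField (toUField W) ⟨z, κ⟩)) φ φH x]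
      have h2 := norm_sub_le (divB (torusT (PV 2 ℓ m K hd3 hL) 0) (fun κ z => unitsField (toUField W) ⟨z, κ⟩) (fun μ => covD (torusT (PV 2 ℓ m K hd3 hL) 0) (fun κ z => unitsField (toUField W) ⟨z, κ⟩) μ φ) x) (divB (torusT (PV 2 ℓ m K hd3 hL) 0) (fun κ z => unitsField (toUField W) ⟨z, κ⟩) (fun ν => covD (torusT (PV 2 ℓ m K hd3 hL) 0) (fun κ z => unitsField (toUField W) ⟨z, κ⟩) ν φH) x)
      linarith [hM x]
    have hbound : ‖divB (torusT (PV 2 ℓ m K hd3 hL) 0) (fun κ z => unitsField (toUField W) ⟨z, κ⟩) (fun μ => covD (torusT (PV 2 ℓ m K hd3 hL) 0) (fun κ z => unitsField (toUField W) ⟨z, κ⟩) μ (fun y => φ y - φH y)) x‖ ≤ (1 + 32768 * Real.sqrt CV) * M := by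
      refine hsplit.trans ?_
      have h : Real.sqrt CV * (((PV 2 ℓ m K hd3 hL).L : ℝ)) ^ (K - n) * 32 * M ≤ Real.sqrt CV * 1024 * 32 * M :=
        mul_le_mul_of_nonneg_right (mul_le_mul_of_nonneg_right (mul_le_mul_of_nonneg_left hlt hsC) (by norm_num)) hM0
      nlinarith [hV, h]
    calc w' x * ‖divB (torusT (PV 2 ℓ m K hd3 hL) 0) (fun κ z => unitsField (toUField W) ⟨z, κ⟩) (fun μ => covD (torusT (PV 2 ℓ m K hd3 hL) 0) (fun κ z => unitsField (toUField W) ⟨z, κ⟩) μ (fun y => φ y - φH y)) x‖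
        ≤ (((PV 2 ℓ m K hd3 hL).L : ℝ)) ^ (K - n) * ((1 + 32768 * Real.sqrt CV) * M) := mul_le_mul (hwℓ x) hbound (norm_nonneg _) hℓk0.le
      _ ≤ (1 + A * 81 * (1 + T₀) ^ 2 * Real.sqrt CV + 32768 * Real.sqrt CV) * (((PV 2 ℓ m K hd3 hL).L : ℝ)) ^ (K - n) * M := by
          have e : (((PV 2 ℓ m K hd3 hL).L : ℝ)) ^ (K - n) * ((1 + 32768 * Real.sqrt CV) * M) = (1 + 32768 * Real.sqrt CV) * ((((PV 2 ℓ m K hd3 hL).L : ℝ)) ^ (K - n) * M) := by ring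
          have e2 : (1 + A * 81 * (1 + T₀) ^ 2 * Real.sqrt CV + 32768 * Real.sqrt CV) * (((PV 2 ℓ m K hd3 hL).L : ℝ)) ^ (K - n) * M
              = (1 + 32768 * Real.sqrt CV) * ((((PV 2 ℓ m K hd3 hL).L : ℝ)) ^ (K - n) * M) + A * 81 * (1 + T₀) ^ 2 * Real.sqrt CV * ((((PV 2 ℓ m K hd3 hL).L : ℝ)) ^ (K - n) * M) := by ring
          rw [e, e2]
          linarith [mul_nonneg (by positivity : (0:ℝ) ≤ A * 81 * (1 + T₀) ^ 2 * Real.sqrt CV) hunit]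
end AllScales

end Summit.QuantumFields.YangMills.Theorems.Prop7CovWeightedRowMemberAllScales

end
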